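import Summits.ResolutionOfSingularities.ResolutionOfSingularities.Theorems.PurelyInseparableDim4ResConeBinaryPairTailThree
import HarnessLib
import HarnessLib.Audit.Tags

/-!
# Purely inseparable four-folds — NO LIGHT BINARY-CONE TAIL ON A PERMANENT BOUNDARY PAIR, WHATEVER THE PASSIVE
# LETTERS DO (K2(p) lane, SLICE C (C10), by the file-holder res-dim4-p-5 g3's signatures; seat res-dim4-p-11 g3)

[OURS · counted 0 · cell `res-dim4-pi` · K2(p) lane (desk WORDs #104/#105; SLICE C file-holder res-dim4-p-5 g3's (C10)
signatures 2026-08-29T00:22:59Z) · seat res-dim4-p-11 g3.]  Nothing here proves K2(p), `NoIsolatedTrap p p` or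
resolution of singularities in dimension ≥ 4 / characteristic `p`.  AI kernel work, weaker than expert review.

(C8) `no_binary_pair_tail` (both passive letters free) and (C9) `no_binary_pair_tail_three` (one passive letter never
translated, the other free) empty the constant-`(d < p, e_G ≡ 2)` tails on a permanent light boundary pair `{a, a′}`
under a STATUS hypothesis on the two passive letters.  Here the status hypothesis is removed:

* §1 **`free_of_translated`** (C10a) — on a tail with chart letters in `{a, a′}`, a passive letter that is translated
  at some step is FREE (`r = 0`, not exceptional) from the next state on, for ever (a translated letter loses its
  component, and a letter that is never the chart letter never regains one);
* §2 **`no_binary_pair_tail_four`** (C10b) — both passive letters never translated: then no step translates at all,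
  the kernel at the child of a letter change is `⟨e_a, e_{a′}⟩` ((C9a) `resVertex_apply_eq_zero_of_untranslated` twice
  + `no_passive_kernel_vector`), and `…CornerEntry.no_frame_at_letter_change` ends the chain;
* §3 **`no_light_pair_tail`** (C10c) — THE STATUS-FREE UNION: each passive letter is either never translated after `k₀`
  or, from its first translation on, free (§1); past both thresholds one of (C8), (C9), (C10b) applies.
Located residual of slice C after this file (holder's words): heavy pairs (B∞-type), tails whose chart letters do not
settle in a boundary pair, and nothing else on the light side.
[cite: CossartJannsenSaito2020, Thm. 3.10(4), Thm. 3.14, Lemma 13.2, Lemma 13.4, Thm. 13.7]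
bears_on: LADDER-RESOLUTION:D157-DOOR2 (res-dim4-pi · K2(p) = `RidgeBudget.NoAboveFloorTrap p p` · slice C).
Supports stmt-ResolutionOfSingularities-16155 (helper).
-/

set_option linter.dupNamespace false -- mandated namespace of this single-conjunct summit

noncomputable section

namespace Summit.ResolutionOfSingularities.ResolutionOfSingularities.Theorems.PIDim4

namespace ResCone

open MvPolynomial Finset
open Literature.AlgebraicGeometry.Resolution
open Literature.AlgebraicGeometry.Resolution.CentreBlowup
open Literature.AlgebraicGeometry.Resolution.Hauser2010
open Literature.AlgebraicGeometry.Resolution.HauserPerlega2019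
open PointBlowup (polarMap additiveSubspace direction)

variable {K : Type} [Field K]

section Light

variable (p : ℕ) [Fact p.Prime] [CharP K p] [DecidableEq K]

/-! ## 1. A translated passive letter is free for ever -/

omit [Fact p.Prime] [CharP K p] in
/-- A translated letter (off the chart letter) is not a boundary component of the child. [folklore]
[cite: HauserPerlega2019PRIMS, §2 (transform of the boundary)] -/
theorem not_mem_step_exc_of_translated {q : ℕ} {s : State K} {j i : Fin 4} (hij : i ≠ j) {b : Fin 4 → K}
    (hbi : b i ≠ 0) : i ∉ (CentreBlowup.step q Finset.univ j b s).exc := by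
  change i ∉ newExc j b s
  unfold newExc
  rw [Finset.mem_insert, Finset.mem_filter]
  rintro (h | ⟨-, h⟩)
  · exact hij h
  · exact hbi h

omit [CharP K p] in
/-- **Permanent boundary letters are never translated**: if `i` stays a boundary letter from `k₀` on then no step
of the tail translates `x_i`. [OURS] [cite: HauserPerlega2019PRIMS, §2] -/
theorem apply_eq_zero_of_permanent {c : ℕ → State K} {j : ℕ → Fin 4} {b : ℕ → Fin 4 → K}
    (hc : ∀ k, IsIsolated p (c k).F ∧ Step0 p (c k) (c (k + 1))) (hw : FreeTail.IsWitnessedChain p c j b)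
    (hr0 : ∀ e ∈ (c 0).F.support, (c 0).r ≤ e) (hfloor : ∀ k, ordZero (c k).F ≠ p) {k₀ : ℕ} {i : Fin 4}
    (hperm : ∀ k, k₀ ≤ k → 1 ≤ (c k).r i) {k : ℕ} (hk : k₀ ≤ k) : b k i = 0 := by
  by_contra hbi
  have hij : i ≠ j k := fun h => hbi (by rw [h]; exact (hw k).2.1)
  obtain ⟨o, ho, -, -⟩ := chain_band p hc hfloor k
  have h0 := step_r_apply_eq_zero_of_ne p (j k) (hw k).2.1 (c k) ho (IsolatedBand.isolated_chain_forall_le hc hr0 k)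
    hij hbi
  rw [← (hw k).2.2.2.2] at h0
  have := hperm (k + 1) (by omega)
  omega

omit [CharP K p] in
/-- **A TRANSLATED PASSIVE LETTER IS FREE FOR EVER** (C10a): on a tail with chart letters in `{a, a′}`, a letter
`i ∉ {a, a′}` translated at step `k ≥ k₀` has `r_n(i) = 0` and `x_i ∉ exc_n` for every `n ≥ k + 1`. [OURS]
[cite: HauserPerlega2019PRIMS, §2 (transform of the boundary)] -/
theorem free_of_translated {c : ℕ → State K} {j : ℕ → Fin 4} {b : ℕ → Fin 4 → K}
    (hc : ∀ k, IsIsolated p (c k).F ∧ Step0 p (c k) (c (k + 1))) (hw : FreeTail.IsWitnessedChain p c j b)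
    (hr0 : ∀ e ∈ (c 0).F.support, (c 0).r ≤ e) (hfloor : ∀ k, ordZero (c k).F ≠ p) {k₀ : ℕ} {a a' : Fin 4}
    (hletters : ∀ k, k₀ ≤ k → (j k = a ∨ j k = a')) {i : Fin 4} (hia : i ≠ a) (hia' : i ≠ a') {k : ℕ}
    (hk : k₀ ≤ k) (hbi : b k i ≠ 0) : ∀ n, k + 1 ≤ n → (c n).r i = 0 ∧ i ∉ (c n).exc := by
  have hji : ∀ n, k₀ ≤ n → j n ≠ i := fun n hn => by
    rcases hletters n hn with h | h <;> rw [h]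
    · exact hia.symm
    · exact hia'.symm
  -- the reset at step `k`
  obtain ⟨o, ho, -, -⟩ := chain_band p hc hfloor k
  have hreset : (c (k + 1)).r i = 0 ∧ i ∉ (c (k + 1)).exc := by
    rw [(hw k).2.2.2.2]
    exact ⟨step_r_apply_eq_zero_of_ne p (j k) (hw k).2.1 (c k) ho (IsolatedBand.isolated_chain_forall_le hc hr0 k)
      (hji k hk).symm hbi, not_mem_step_exc_of_translated (hji k hk).symm hbi⟩
  -- then the letter stays free along the shifted chain (never the chart letter)
  have hwT : FreeTail.IsWitnessedChain p (fun n => c (k + 1 + n)) (fun n => j (k + 1 + n)) (fun n => b (k + 1 + n)) := by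
    intro n
    have h := hw (k + 1 + n)
    rwa [show k + 1 + n + 1 = k + 1 + (n + 1) by ring] at h
  intro n hn
  obtain ⟨m, rfl⟩ : ∃ m, n = k + 1 + m := ⟨n - (k + 1), by omega⟩
  exact FrameChange.free_of_isWitnessedChain hwT (fun m => hji (k + 1 + m) (by omega))
    (by show (c (k + 1 + 0)).r i = 0; rw [Nat.add_zero]; exact hreset.1)
    (by show i ∉ (c (k + 1 + 0)).exc; rw [Nat.add_zero]; exact hreset.2) m

/-! ## 2. Both passive letters never translated -/

/-- The class-level theorem at a given letter change `a′ → a`, both passive letters never translated. [OURS]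
[cite: CossartJannsenSaito2020, Thm. 3.10(4), Thm. 3.14, Lemma 13.2] -/
theorem no_binary_pair_tail_four_at {c : ℕ → State K} {j : ℕ → Fin 4} {b : ℕ → Fin 4 → K}
    (hc : ∀ k, IsIsolated p (c k).F ∧ Step0 p (c k) (c (k + 1))) (hw : FreeTail.IsWitnessedChain p c j b)
    (hr0 : ∀ e ∈ (c 0).F.support, (c 0).r ≤ e) (hfloor : ∀ k, ordZero (c k).F ≠ p) {k₀ d : ℕ} (hdp : d < p)
    (hshade : ∀ k, k₀ ≤ k → (c k).shade = (d : ℕ∞)) {a a' c₁ c₂ : Fin 4} (haa : a ≠ a') (hc₁a : c₁ ≠ a)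
    (hc₁a' : c₁ ≠ a') (hc₂a : c₂ ≠ a) (hc₂a' : c₂ ≠ a') (hc₁₂ : c₁ ≠ c₂)
    (hletters : ∀ k, k₀ ≤ k → (j k = a ∨ j k = a'))
    (he : ∀ k, k₀ ≤ k → Module.finrank K (resVertex (c k)) = 2)
    (hbdry : ∀ k, k₀ ≤ k → 1 ≤ (c k).r a ∧ 1 ≤ (c k).r a')
    (huntr₁ : ∀ k, k₀ ≤ k → b k c₁ = 0) (huntr₂ : ∀ k, k₀ ≤ k → b k c₂ = 0)
    (hlight : ∀ k, k₀ ≤ k → (c k).r a + (c k).r a' ≤ 2 * (c (k + 1)).r (j k))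
    {k₁ : ℕ} (hk₁ : k₀ ≤ k₁) (hj₁ : j k₁ = a') (hj₂ : j (k₁ + 1) = a) : False := by
  have hfour := eq_or_eq_or_eq_or_eq haa hc₁a hc₁a' hc₂a hc₂a' hc₁₂.symm
  -- no step translates at all
  have hba : ∀ k, k₀ ≤ k → b k a = 0 ∧ b k a' = 0 := fun k hk =>
    ⟨apply_eq_zero_of_permanent p hc hw hr0 hfloor (fun k hk => (hbdry k hk).1) hk,
      apply_eq_zero_of_permanent p hc hw hr0 hfloor (fun k hk => (hbdry k hk).2) hk⟩
  have hb0 : ∀ k, k₀ ≤ k → b k = 0 := by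
    intro k hk
    funext i
    rcases hfour i with h | h | h | h <;> rw [h]
    · exact (hba k hk).1
    · exact (hba k hk).2
    · exact huntr₁ k hk
    · exact huntr₂ k hk
  have hfreeT : ∀ k, k₀ ≤ k → ∀ i, b k i ≠ 0 → (c k).r i = 0 := fun k hk i hbi =>
    absurd (by rw [hb0 k hk]; rfl) hbi
  set m := k₁ + 1 with hm
  -- `e_a` is the direction of the `a`-step `m`
  have hea : (Pi.single a 1 : Fin 4 → K) ∈ resVertex (c m) := by
    have hv := chain_direction_mem_resVertex p hc hw hr0 hfloor hshade (k := m) (by omega)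
    have hdir : direction (j m) (b m) = Pi.single a 1 := by
      funext i
      rw [hj₂]
      by_cases hia : i = a
      · rw [hia, direction_apply_self, Pi.single_eq_same]
      · rw [direction_apply_of_ne hia, Pi.single_eq_of_ne hia, hb0 m (by omega)]; rfl
    rwa [hdir] at hv
  -- `e_{a′}` spans the line `resVertex (c m) ⊓ H_a`: its generator is `c₁`-, `c₂`- and `a`-free
  obtain ⟨o, ho, hpo, ho2⟩ := chain_band p hc hfloor m
  have hrm := IsolatedBand.isolated_chain_forall_le hc hr0 m
  have heqsh : (CentreBlowup.step p Finset.univ (j m) (b m) (c m)).shade = (c m).shade :=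
    chain_shade_step p hw hshade (k := m) (by omega)
  have hline : Module.finrank K ↥(resVertex (c m) ⊓ hyperplane a) = 1 := by
    have h := finrank_resVertex_inf_hyperplane_add_one (j m) (hw m).2.1 ho hrm hpo ho2 heqsh
    rw [hj₂, he m (by omega)] at h
    omega
  obtain ⟨π, hπ, hπ0⟩ : ∃ π ∈ resVertex (c m) ⊓ hyperplane a, π ≠ 0 := by
    by_contra h
    push Not at h
    have hbot : resVertex (c m) ⊓ hyperplane a = ⊥ := by
      rw [Submodule.eq_bot_iff]; exact h
    rw [hbot, finrank_bot] at hline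
    exact zero_ne_one hline
  have hπV : π ∈ resVertex (c m) := (Submodule.mem_inf.mp hπ).1
  have hπa : π a = 0 := mem_hyperplane.mp (Submodule.mem_inf.mp hπ).2
  have hπa' : π a' ≠ 0 := fun h0 =>
    hπ0 (no_passive_kernel_vector p hc hw hr0 hfloor hshade he hletters (k := m) (by omega) hπV hπa h0)
  have hπc₁ : π c₁ = 0 :=
    resVertex_apply_eq_zero_of_untranslated p hc hw hr0 hfloor hshade he hletters hba hc₁a hc₁a' huntr₁ (k := m)
      (by omega) π hπV
  have hπc₂ : π c₂ = 0 :=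
    resVertex_apply_eq_zero_of_untranslated p hc hw hr0 hfloor hshade he hletters hba hc₂a hc₂a' huntr₂ (k := m)
      (by omega) π hπV
  have hea' : (Pi.single a' 1 : Fin 4 → K) ∈ resVertex (c m) := by
    have hπeq : (Pi.single a' 1 : Fin 4 → K) = (π a')⁻¹ • π := by
      funext i
      rw [Pi.smul_apply, smul_eq_mul]
      rcases hfour i with h | h | h | h <;> rw [h]
      · rw [Pi.single_eq_of_ne haa, hπa, mul_zero]
      · rw [Pi.single_eq_same, inv_mul_cancel₀ hπa']
      · rw [Pi.single_eq_of_ne hc₁a', hπc₁, mul_zero]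
      · rw [Pi.single_eq_of_ne hc₂a', hπc₂, mul_zero]
    rw [hπeq]
    exact Submodule.smul_mem _ _ hπV
  exact no_frame_at_letter_change p hc hw hr0 hfloor hdp hshade haa hletters he hbdry hlight hfreeT hk₁ hj₁ hj₂
    ⟨hea, hea'⟩

/-- **NO BINARY-CONE TAIL WITH BOTH PASSIVE LETTERS NEVER TRANSLATED** (C10b): no isolated above-floor witnessed
`Step0 p` chain with `x^{r₀} ∣ F₀` has, from some `k₀` on, constant natural shade `d < p`, `e_G ≡ 2`, chart letters in
`{a, a′}`, `a, a′` permanent boundary letters, light letters, and the two other letters NEVER translated. [OURS]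
[cite: CossartJannsenSaito2020, Thm. 3.10(4), Thm. 3.14, Lemma 13.2] -/
theorem no_binary_pair_tail_four {c : ℕ → State K} {j : ℕ → Fin 4} {b : ℕ → Fin 4 → K}
    (hc : ∀ k, IsIsolated p (c k).F ∧ Step0 p (c k) (c (k + 1))) (hw : FreeTail.IsWitnessedChain p c j b)
    (hr0 : ∀ e ∈ (c 0).F.support, (c 0).r ≤ e) (hfloor : ∀ k, ordZero (c k).F ≠ p) {k₀ d : ℕ} (hdp : d < p)
    (hshade : ∀ k, k₀ ≤ k → (c k).shade = (d : ℕ∞)) {a a' c₁ c₂ : Fin 4} (haa : a ≠ a') (hc₁a : c₁ ≠ a)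
    (hc₁a' : c₁ ≠ a') (hc₂a : c₂ ≠ a) (hc₂a' : c₂ ≠ a') (hc₁₂ : c₁ ≠ c₂)
    (hletters : ∀ k, k₀ ≤ k → (j k = a ∨ j k = a'))
    (he : ∀ k, k₀ ≤ k → Module.finrank K (resVertex (c k)) = 2)
    (hbdry : ∀ k, k₀ ≤ k → 1 ≤ (c k).r a ∧ 1 ≤ (c k).r a')
    (huntr₁ : ∀ k, k₀ ≤ k → b k c₁ = 0) (huntr₂ : ∀ k, k₀ ≤ k → b k c₂ = 0)
    (hlight : ∀ k, k₀ ≤ k → (c k).r a + (c k).r a' ≤ 2 * (c (k + 1)).r (j k)) : False := by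
  have hsat : ∃ n, k₀ ≤ n ∧ FreeTail.IsSatellite j b n := by
    by_contra h
    push Not at h
    obtain ⟨m, hm⟩ := FreeTailProof.noIsolatedFreeTailAt_self p K c j b k₀ hw h
    exact hm (hc m).1
  obtain ⟨n, hn, hsatn⟩ := hsat
  have hchg : j (n + 1) ≠ j n := hsatn.1
  rcases hletters n hn with hja | hja'
  · have hja'2 : j (n + 1) = a' := by
      rcases hletters (n + 1) (by omega) with h | h
      · exact absurd (h.trans hja.symm) hchg
      · exact h
    exact no_binary_pair_tail_four_at p hc hw hr0 hfloor hdp hshade haa.symm hc₁a' hc₁a hc₂a' hc₂a hc₁₂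
      (fun k hk => (hletters k hk).symm) he (fun k hk => (hbdry k hk).symm) huntr₁ huntr₂
      (fun k hk => by rw [add_comm]; exact hlight k hk) hn hja hja'2
  · have hja2 : j (n + 1) = a := by
      rcases hletters (n + 1) (by omega) with h | h
      · exact h
      · exact absurd (h.trans hja'.symm) hchg
    exact no_binary_pair_tail_four_at p hc hw hr0 hfloor hdp hshade haa hc₁a hc₁a' hc₂a hc₂a' hc₁₂ hletters he hbdry
      huntr₁ huntr₂ hlight hn hja' hja2

/-! ## 3. The status-free union -/

/-- **NO LIGHT BINARY-CONE TAIL ON A PERMANENT BOUNDARY PAIR, WHATEVER THE PASSIVE LETTERS DO** (C10c; every prime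
`p`, every `d < p`): no isolated above-floor witnessed `Step0 p` chain with `x^{r₀} ∣ F₀` has, from some `k₀` on,
constant natural shade `d < p`, `e_G ≡ 2`, chart letters in `{a, a′}`, `a, a′` permanent boundary letters and light
letters `r_k(a) + r_k(a′) ≤ 2 r_{k+1}(j k)` — NO hypothesis on the two passive letters: each is never translated after
`k₀` or free from its first translation on (`free_of_translated`); past both thresholds one of
`no_binary_pair_tail` (C8), `no_binary_pair_tail_three` (C9), `no_binary_pair_tail_four` (§2) applies. [OURS]
[cite: CossartJannsenSaito2020, Thm. 3.10(4), Thm. 3.14, Lemma 13.2, Lemma 13.4, Thm. 13.7] -/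
theorem no_light_pair_tail {c : ℕ → State K} {j : ℕ → Fin 4} {b : ℕ → Fin 4 → K}
    (hc : ∀ k, IsIsolated p (c k).F ∧ Step0 p (c k) (c (k + 1))) (hw : FreeTail.IsWitnessedChain p c j b)
    (hr0 : ∀ e ∈ (c 0).F.support, (c 0).r ≤ e) (hfloor : ∀ k, ordZero (c k).F ≠ p) {k₀ d : ℕ} (hdp : d < p)
    (hshade : ∀ k, k₀ ≤ k → (c k).shade = (d : ℕ∞)) {a a' : Fin 4} (haa : a ≠ a')
    (hletters : ∀ k, k₀ ≤ k → (j k = a ∨ j k = a'))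
    (he : ∀ k, k₀ ≤ k → Module.finrank K (resVertex (c k)) = 2)
    (hbdry : ∀ k, k₀ ≤ k → 1 ≤ (c k).r a ∧ 1 ≤ (c k).r a')
    (hlight : ∀ k, k₀ ≤ k → (c k).r a + (c k).r a' ≤ 2 * (c (k + 1)).r (j k)) : False := by
  obtain ⟨c₁, c₂, hc₁₂, hc₁a, hc₁a', hc₂a, hc₂a', hcompl⟩ := exists_pair_compl haa
  -- each passive letter: a threshold after which it is never translated, or after which it is free
  have hthr : ∀ i, i ≠ a → i ≠ a' → ∃ k₂, k₀ ≤ k₂ ∧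
      ((∀ k, k₂ ≤ k → b k i = 0) ∨ (∀ k, k₂ ≤ k → (c k).r i = 0 ∧ i ∉ (c k).exc)) := by
    intro i hia hia'
    by_cases h : ∃ k, k₀ ≤ k ∧ b k i ≠ 0
    · obtain ⟨k, hk, hbi⟩ := h
      exact ⟨k + 1, by omega, Or.inr (free_of_translated p hc hw hr0 hfloor hletters hia hia' hk hbi)⟩
    · push Not at h
      exact ⟨k₀, le_rfl, Or.inl h⟩
  obtain ⟨k₁, hk₁, h₁⟩ := hthr c₁ hc₁a hc₁a'
  obtain ⟨k₂, hk₂, h₂⟩ := hthr c₂ hc₂a hc₂a'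
  -- the common tail from `k₃ = max k₁ k₂`
  set k₃ := max k₁ k₂ with hk₃
  have hk₀₃ : k₀ ≤ k₃ := le_trans hk₁ (le_max_left _ _)
  have hshade₃ : ∀ k, k₃ ≤ k → (c k).shade = (d : ℕ∞) := fun k hk => hshade k (by omega)
  have hletters₃ : ∀ k, k₃ ≤ k → (j k = a ∨ j k = a') := fun k hk => hletters k (by omega)
  have he₃ : ∀ k, k₃ ≤ k → Module.finrank K (resVertex (c k)) = 2 := fun k hk => he k (by omega)
  have hbdry₃ : ∀ k, k₃ ≤ k → 1 ≤ (c k).r a ∧ 1 ≤ (c k).r a' := fun k hk => hbdry k (by omega)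
  have hlight₃ : ∀ k, k₃ ≤ k → (c k).r a + (c k).r a' ≤ 2 * (c (k + 1)).r (j k) := fun k hk => hlight k (by omega)
  rcases h₁ with hu₁ | hf₁ <;> rcases h₂ with hu₂ | hf₂
  · -- both never translated
    exact no_binary_pair_tail_four p hc hw hr0 hfloor hdp hshade₃ haa hc₁a hc₁a' hc₂a hc₂a' hc₁₂ hletters₃ he₃ hbdry₃
      (fun k hk => hu₁ k (le_trans (le_max_left _ _) hk)) (fun k hk => hu₂ k (le_trans (le_max_right _ _) hk)) hlight₃
  · -- `c₁` never translated, `c₂` free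
    exact no_binary_pair_tail_three p hc hw hr0 hfloor hdp hshade₃ haa hc₁a hc₁a' hc₂a hc₂a' hc₁₂.symm hletters₃ he₃
      hbdry₃ (fun k hk => hu₁ k (le_trans (le_max_left _ _) hk))
      (fun k hk => hf₂ k (le_trans (le_max_right _ _) hk)) hlight₃
  · -- `c₂` never translated, `c₁` free
    exact no_binary_pair_tail_three p hc hw hr0 hfloor hdp hshade₃ haa hc₂a hc₂a' hc₁a hc₁a' hc₁₂ hletters₃ he₃
      hbdry₃ (fun k hk => hu₂ k (le_trans (le_max_right _ _) hk))
      (fun k hk => hf₁ k (le_trans (le_max_left _ _) hk)) hlight₃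
  · -- both free
    exact no_binary_pair_tail p hc hw hr0 hfloor hdp hshade₃ haa hletters₃ he₃ hbdry₃
      (fun k hk i hi₁ hi₂ => by
        by_cases hic₁ : i = c₁
        · rw [hic₁]; exact hf₁ k (le_trans (le_max_left _ _) hk)
        by_cases hic₂ : i = c₂
        · rw [hic₂]; exact hf₂ k (le_trans (le_max_right _ _) hk)
        rcases hcompl i hic₁ hic₂ with h | h
        · exact absurd h hi₁
        · exact absurd h hi₂)
      hlight₃

end Light

end ResCone

end Summit.ResolutionOfSingularities.ResolutionOfSingularities.Theorems.PIDim4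

end
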